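import Summits.QuantumAdvantage.QuantumAdvantage.Theses.LinnikCubicClassGroups
import Literature.Computability.Complexity.Randomized
import Literature.Computability.Complexity.ProbabilisticClasses
import Literature.Computability.Complexity.Nondeterministic
import HarnessLib

/-!
# Stub-ideation sketch (ideator 3, FAMILY 3 — probe the extremes) for `stub_phiHiding3`
of crux `PureCubicClassNumberHard` (stmt-QuantumAdvantage-11826), line `Sketch` (honda-leak).

Only the STATEMENTS of the proposed helper lemmas are checked here (bodies `sorry`);
see `STUB-IDEAS-stub_phiHiding3-3.md`.
-/

set_option linter.dupNamespace false

namespace Summit.QuantumAdvantage.QuantumAdvantage.Cruxes.PureCubicClassNumberHard.StubIdeas3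

open Literature.Computability.Complexity _root_.Computability

/-- The promise family of the stub. -/
def InFamily (p q : ℕ) : Prop :=
  p.Prime ∧ q.Prime ∧ p ≠ q ∧ (p * q) % 9 = 1 ∧
    ((p % 3 = 1 ∧ q % 3 = 1) ∨ (p % 9 = 2 ∧ q % 9 = 5) ∨ (p % 9 = 5 ∧ q % 9 = 2))

/-- The correctness clause of the stub for an algorithm `D` and a target bit. -/
def DecidesOnFamily (D : RandAlg (List Bool) Bool) (bit : ℕ → ℕ → Bool) : Prop :=
  ∀ p q : ℕ, p.Prime → q.Prime → p ≠ q → (p * q) % 9 = 1 →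
    ((p % 3 = 1 ∧ q % 3 = 1) ∨ (p % 9 = 2 ∧ q % 9 = 5) ∨ (p % 9 = 5 ∧ q % 9 = 2)) →
    (2 : ℝ) / 3 ≤ D.pr id (encodeNat (p * q)) {b | b = bit p q}

/-- The stub, verbatim (`stub_phiHiding3` of `Lines/Sketch.lean`). -/
def PhiHiding3 : Prop :=
  ¬ ∃ D : RandAlg (List Bool) Bool, D.IsPolyTime id encodeBool ∧
    ∀ p q : ℕ, p.Prime → q.Prime → p ≠ q → (p * q) % 9 = 1 →
      ((p % 3 = 1 ∧ q % 3 = 1) ∨ (p % 9 = 2 ∧ q % 9 = 5) ∨ (p % 9 = 5 ∧ q % 9 = 2)) →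
      (2 : ℝ) / 3 ≤ D.pr id (encodeNat (p * q)) {b | b = decide (p % 3 = 1)}

/-- Sanity: the abstraction is definitional. -/
theorem phiHiding3_iff : PhiHiding3 ↔
    ¬ ∃ D : RandAlg (List Bool) Bool, D.IsPolyTime id encodeBool ∧
      DecidesOnFamily D (fun p _ => decide (p % 3 = 1)) := Iff.rfl

/-! ## Plan A — anatomy of a minimal counterexample: the hidden bit is `[-3 is a square mod N]` -/

/-- A1. For a prime `p > 3`: `-3` is a square mod `p` iff `p ≡ 1 (mod 3)`. -/
theorem isSquare_neg_three_iff {p : ℕ} (hp : p.Prime) (h2 : p ≠ 2) (h3 : p ≠ 3) :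
    IsSquare (-3 : ZMod p) ↔ p % 3 = 1 := by
  sorry

/-- A2. On the promise family the hidden Eisenstein type is quadratic residuosity of `-3` mod `N`. -/
theorem type_iff_isSquare_neg_three {p q : ℕ} (hp : p.Prime) (hq : q.Prime) (hpq : p ≠ q)
    (h9 : (p * q) % 9 = 1)
    (ht : (p % 3 = 1 ∧ q % 3 = 1) ∨ (p % 9 = 2 ∧ q % 9 = 5) ∨ (p % 9 = 5 ∧ q % 9 = 2)) :
    p % 3 = 1 ↔ IsSquare (-3 : ZMod (p * q)) := by
  sorry

/-- A3. The stub, re-typed: worst-case hardness of QR(-3) on Eisenstein-typed RSA moduli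
(Adleman–McCurley 1994, problem C11, for the fixed residue `a = -3`). -/
theorem phiHiding3_iff_qrNegThreeHard :
    PhiHiding3 ↔ ¬ ∃ D : RandAlg (List Bool) Bool, D.IsPolyTime id encodeBool ∧
      ∀ p q : ℕ, p.Prime → q.Prime → p ≠ q → (p * q) % 9 = 1 →
        ((p % 3 = 1 ∧ q % 3 = 1) ∨ (p % 9 = 2 ∧ q % 9 = 5) ∨ (p % 9 = 5 ∧ q % 9 = 2)) →
        (2 : ℝ) / 3 ≤ D.pr id (encodeNat (p * q)) {b | b = true ↔ IsSquare (-3 : ZMod (p * q))} := by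
  sorry

/-! ## Plan B — extremes of the signature: inhabited types, no cheap leak, i.o.-stability -/

/-- B1a (PROVED). The inert type is inhabited by the smallest instance `N = 10`. -/
theorem inFamily_two_five : InFamily 2 5 := by
  unfold InFamily; norm_num

/-- B1b (PROVED). The split type is inhabited by `N = 91`. -/
theorem inFamily_seven_thirteen : InFamily 7 13 := by
  unfold InFamily; norm_num

/-- B1c (PROVED). No constant (coin-free) answer satisfies the correctness clause
(instances `N = 91` and `N = 10`; `RandAlg.pr_ofDet`). -/
theorem not_decidesOnFamily_const (b₀ : Bool) :
    ¬ DecidesOnFamily (RandAlg.ofDet fun _ => b₀) (fun p _ => decide (p % 3 = 1)) := by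
  intro h
  cases b₀
  · have h91 := h 7 13 (by norm_num) (by norm_num) (by norm_num) (by norm_num)
      (Or.inl ⟨by norm_num, by norm_num⟩)
    rw [RandAlg.pr_ofDet] at h91
    norm_num at h91
  · have h10 := h 2 5 (by norm_num) (by norm_num) (by norm_num) (by norm_num)
      (Or.inr (Or.inl ⟨by norm_num, by norm_num⟩))
    rw [RandAlg.pr_ofDet] at h10
    norm_num at h10

/-- A2 at the two extreme instances: `-3` is a square mod `91 = 7·13` (split) … -/
example : IsSquare (-3 : ZMod 91) := ⟨58, by decide⟩
/-- … and not mod `10 = 2·5` (inert). -/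
example : ¬ IsSquare (-3 : ZMod 10) := by decide

/-- C1a at the extreme instances. -/
example : ∃ d, 1 < d ∧ d < 91 ∧ d ∣ 91 ∧ d % 3 = 1 := ⟨7, by norm_num⟩
example : ¬ ∃ d, 1 < d ∧ d < 10 ∧ d ∣ 10 ∧ d % 3 = 1 := by
  rintro ⟨d, h1, h2, h3, h4⟩
  interval_cases d <;> omega

/-- B3 at the smallest odd instances of each type (`55 = 5·11` inert, `91` split). -/
example : jacobiSym (-3) 91 = 1 := by norm_num [jacobiSym]
example : jacobiSym (-3) 55 = 1 := by norm_num [jacobiSym]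

/-- B2. 3-adic no-leak: every unit class `c ≡ 1 (mod 9)` modulo `3^k` contains products `pq` of
BOTH types (CRT in `(ℤ/3^k)ˣ ≅ C₂ × C_{3^{k-1}}` + Dirichlet, Mathlib
`Nat.forall_exists_prime_gt_and_modEq`). -/
theorem threeAdic_noLeak (k : ℕ) (hk : 2 ≤ k) (c : ℕ) (hc : c % 9 = 1) :
    (∃ p q : ℕ, p.Prime ∧ q.Prime ∧ p ≠ q ∧ p % 3 = 1 ∧ q % 3 = 1 ∧
        (p * q) % 3 ^ k = c % 3 ^ k) ∧
    (∃ p q : ℕ, p.Prime ∧ q.Prime ∧ p % 9 = 2 ∧ q % 9 = 5 ∧ (p * q) % 3 ^ k = c % 3 ^ k) := by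
  sorry

/-- B3. Quadratic-character no-leak: on odd members of the family `J(-3 | pq) = 1` in both types. -/
theorem jacobiSym_neg_three_eq_one {p q : ℕ} (hp : p.Prime) (hq : q.Prime) (hp2 : p ≠ 2)
    (hq2 : q ≠ 2)
    (ht : (p % 3 = 1 ∧ q % 3 = 1) ∨ (p % 9 = 2 ∧ q % 9 = 5) ∨ (p % 9 = 5 ∧ q % 9 = 2)) :
    jacobiSym (-3) (p * q) = 1 := by
  sorry

/-- B4a. Both types occur infinitely often (Dirichlet). -/
theorem infinite_family_both_types :
    {N : ℕ | ∃ p q, InFamily p q ∧ p % 3 = 1 ∧ N = p * q}.Infinite ∧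
    {N : ℕ | ∃ p q, InFamily p q ∧ p % 9 = 2 ∧ N = p * q}.Infinite := by
  sorry

/-- B4b. Worst-case = infinitely-often for the stub (port of Disproof §7 `hard_iff_infinitely_often`
/ `isPolyTime_patch` to `Bool` outputs). -/
theorem phiHiding3_iff_io :
    PhiHiding3 ↔ ∀ D : RandAlg (List Bool) Bool, D.IsPolyTime id encodeBool →
      {N : ℕ | ∃ p q, InFamily p q ∧ N = p * q ∧
        D.pr id (encodeNat (p * q)) {b | b = decide (p % 3 = 1)} < 2 / 3}.Infinite := by
  sorry

/-- B5 (optional, autopsy of the Euler-criterion statistic `[a^((N-1)/3) = 1]`): the number of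
`e`-th roots of unity mod `pq` is `gcd(e, p-1) · gcd(e, q-1)`, so the statistic has density
`≤ 9 · gcd(p-1, q-1)² / φ(N)` — negligible off the (factorable) extremal sub-family. -/
theorem card_pow_eq_one_units_zmod_mul {p q : ℕ} (hp : p.Prime) (hq : q.Prime) (hpq : p ≠ q)
    (e : ℕ) :
    Nat.card {a : (ZMod (p * q))ˣ // a ^ e = 1} = Nat.gcd e (p - 1) * Nat.gcd e (q - 1) := by
  sorry

/-! ## Plan C — perturb the proved neighbour (`BQP ⊆ BPP ⊢ ¬stub`, c2) and the one honest assembly -/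

/-- C1a. Divisor criterion: on the family, `N` has a proper divisor `≡ 1 (mod 3)` iff split type. -/
theorem exists_divisor_mod_three_iff {p q : ℕ} (hp : p.Prime) (hq : q.Prime) (hpq : p ≠ q)
    (ht : (p % 3 = 1 ∧ q % 3 = 1) ∨ (p % 9 = 2 ∧ q % 9 = 5) ∨ (p % 9 = 5 ∧ q % 9 = 2)) :
    (∃ d, 1 < d ∧ d < p * q ∧ d ∣ p * q ∧ d % 3 = 1) ↔ p % 3 = 1 := by
  sorry

/-- C1b. Under `NP ⊆ BPP` the stub is FALSE (the NP language "N has a proper divisor ≡ 1 (mod 3)"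
is then in BPP; `npLang_mem_NP`, `mem_BPP_iff_randAlg_holds`). -/
theorem exists_decider_of_NP_subset_BPP (h : Nondeterministic.NP ⊆ BPP) :
    ∃ D : RandAlg (List Bool) Bool, D.IsPolyTime id encodeBool ∧
      ∀ p q : ℕ, p.Prime → q.Prime → p ≠ q → (p * q) % 9 = 1 →
        ((p % 3 = 1 ∧ q % 3 = 1) ∨ (p % 9 = 2 ∧ q % 9 = 5) ∨ (p % 9 = 5 ∧ q % 9 = 2)) →
        (2 : ℝ) / 3 ≤ D.pr id (encodeNat (p * q)) {b | b = decide (p % 3 = 1)} := by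
  sorry

/-- C1c. Hence the leaf is `P ≠ NP`-hard to prove. -/
theorem not_NP_subset_BPP_of_phiHiding3 (h : PhiHiding3) : ¬ Nondeterministic.NP ⊆ BPP :=
  fun hNP => h (exists_decider_of_NP_subset_BPP hNP)

open scoped Classical in
/-- The `n`-bit slice of the promise family. -/
noncomputable def famSlice (n : ℕ) : Finset (ℕ × ℕ) :=
  ((Finset.range (2 ^ n)) ×ˢ (Finset.range (2 ^ n))).filter
    fun pq => 2 ^ (n - 1) ≤ pq.1 ∧ 2 ^ (n - 1) ≤ pq.2 ∧ InFamily pq.1 pq.2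

/-- C2a (definition request, conjecture-grade, would live as `@[conjecture] def` under Theorems/):
the WEAKEST average-case form of Cachin–Micali–Stadler's Φ-Hiding Assumption for `e = 3` on the
pure-cubic sampler — every PPT `D` has average success `< 2/3` on the `n`-bit slice for
infinitely many `n`. -/
def PhiHidingThreeAvg : Prop :=
  ∀ D : RandAlg (List Bool) Bool, D.IsPolyTime id encodeBool →
    {n : ℕ | (famSlice n).Nonempty ∧
      (∑ pq ∈ famSlice n, D.pr id (encodeNat (pq.1 * pq.2)) {b | b = decide (pq.1 % 3 = 1)}) /
        ((famSlice n).card : ℝ) < 2 / 3}.Infinite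

/-- C2b. The only assembly `⇒ stub` that exists: average-case hardness implies worst-case
hardness (averaging). -/
theorem phiHiding3_of_avg (h : PhiHidingThreeAvg) : PhiHiding3 := by
  sorry

end Summit.QuantumAdvantage.QuantumAdvantage.Cruxes.PureCubicClassNumberHard.StubIdeas3
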